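import Summits.QuantumFields.YangMills.Theorems.PoincareLipschitzBlowDownL2Compactness
import Literature.Analysis.FunctionSpaces.DiagonalWeakLimits
import Mathlib.MeasureTheory.Function.ContinuousMapDense
import Mathlib.MeasureTheory.Function.L2Space
import HarnessLib

/-!
# (Γ2-W) The weak `L²` limit from dyadic means

Brick (Γ2-W) of LINE 25 «CompactnessTransfer» (crux `PoincareLipschitz.BlockLipschitzL`,
stmt-QuantumFields-23533; crux of record `UnitScaleTilt.HistoryTailL`, stmt-QuantumFields-19936;
LEAD ★w1-19936 g9 2026-08-29 12:02:03Z GO): the `(c4) → Γ2` bridge.  Γ1's registered conclusion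
`(c4)` says that along the extracted subsequence every DYADIC-CELL MEAN of the rescaled lattice
difference quotients `v k` converges; together with the energy bound `∫_Q ‖v k‖² ≤ Λ` this gives
ONE weak `L²(Q; ℝ⁴)` limit `G` ALONG THE WHOLE SEQUENCE, with `∫_Q ‖G‖² ≤ Λ`, whose cell means are
the limits of the cell means, and against which the pairings with every `ψ ∈ L²` and every
bounded measurable scalar test function `φ` converge — the pairing the `HasWeakFDerivOn` identity of
S2♭″ consumes (`exists_weakLimit_of_dyadicMeans`).

Route: the abstract step is the tree's Literature letter
`Literature.Analysis.FunctionSpaces.exists_mem_tendsto_inner_of_subset_closure_span` (file `DiagonalWeakLimits`)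
(weak limits from pairings on a set with dense span, Leray 1934 §28) applied in the Hilbert space
`Lp F 2 (volume.restrict Q)` with `S` = dyadic-cell indicators times constant vectors
(`exists_weakLimit_of_setIntegral_tendsto`, §2); the concrete step is the DENSITY of their span
(`dense_span_indicatorConstLp_dyadicCell`, §3: bounded continuous functions are dense —
`MemLp.exists_boundedContinuous_eLpNorm_sub_le` — and are uniformly approximated on the compact
cube by dyadic step functions); §1 holds the cube/cell letters not already in ✓`PoincareLipschitzBlowDownL2Compactness` (cells in Γ1's registered `(c4)`
lettering `{x | ∀ i, -1 + 2 jᵢ/2^m ≤ xᵢ < -1 + 2 (jᵢ+1)/2^m}`, `j : Fin 3 → Fin (2^m)`; the faces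
`{xᵢ = -1}` are Lebesgue-null, so `volume.restrict` of the half-open cube equals that of the open
cube `Q = {|xᵢ| < 1}`).

HONEST: a helper (`--supports stmt-QuantumFields-19936 --as helper`); nothing of Γ2, S2♭″,
`BlockLipschitzL`, `HistoryTailL` is proved here; rung R3 = YM₃ on T³ — not d = 4, not Clay.
-/

set_option autoImplicit false

open MeasureTheory Filter Topology Set
open scoped RealInnerProductSpace ENNReal BigOperators

namespace Summit.QuantumFields.YangMills.Theorems.PoincareLipschitzDyadicMeansWeakLimit

open Summit.QuantumFields.YangMills.Theorems.PoincareLipschitzSamplingCells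
  (isOpen_absCube isCompact_absCubeClosed volume_real_absCube)
open Summit.QuantumFields.YangMills.Theorems.PoincareLipschitzBlowDownCells (measurable_coord)
open Summit.QuantumFields.YangMills.Theorems.PoincareLipschitzBlowDownModulus
  (measurableSet_halfOpenCube openCube_subset_halfOpenCube)
open Summit.QuantumFields.YangMills.Theorems.PoincareLipschitzBlowDownL2Compactness
  (measurableSet_dyadicCube dyadicCube_subset_halfOpenCube)

/-! ## §1 Cube and dyadic-cell letters -/

/-- The three lower faces `{xᵢ = -1}` of the cube are Lebesgue-null in `ℝ³` (product structure of
Lebesgue measure, `Measure.pi_hyperplane`). [folklore] -/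
theorem volume_iUnion_lowerFaces_eq_zero :
    volume (⋃ i : Fin 3, {x : EuclideanSpace ℝ (Fin 3) | x i = (-1 : ℝ)}) = 0 := by
  refine measure_iUnion_null fun i => ?_
  have h : {x : EuclideanSpace ℝ (Fin 3) | x i = (-1 : ℝ)} =
      (WithLp.ofLp : EuclideanSpace ℝ (Fin 3) → (Fin 3 → ℝ)) ⁻¹' {f | f i = (-1 : ℝ)} := by
    ext x; simp
  have hmeas : MeasurableSet {f : Fin 3 → ℝ | f i = (-1 : ℝ)} :=
    measurableSet_eq_fun (measurable_pi_apply i) measurable_const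
  rw [h, (PiLp.volume_preserving_ofLp (Fin 3)).measure_preimage hmeas.nullMeasurableSet,
    volume_pi]
  exact Measure.pi_hyperplane (fun _ : Fin 3 => (volume : Measure ℝ)) i (-1)

/-- The half-open cube and the open cube differ by a Lebesgue-null set (three faces). [folklore] -/
theorem volume_halfOpenCube_diff_openCube :
    volume ({x : EuclideanSpace ℝ (Fin 3) | ∀ i : Fin 3, (-1 : ℝ) ≤ x i ∧ x i < 1} \
      {x : EuclideanSpace ℝ (Fin 3) | ∀ i : Fin 3, |x i| < 1}) = 0 := by
  refine measure_mono_null (fun x hx => ?_) volume_iUnion_lowerFaces_eq_zero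
  obtain ⟨hC, hQ⟩ := hx
  simp only [mem_setOf_eq, not_forall, not_lt] at hQ
  obtain ⟨i, hi⟩ := hQ
  refine mem_iUnion.2 ⟨i, ?_⟩
  obtain ⟨h1, h2⟩ := hC i
  have : x i ≤ -1 := by
    rcases le_abs.1 hi with h | h <;> linarith
  exact le_antisymm this h1

/-- `volume.restrict [-1,1)³ = volume.restrict Q`: the two cubes carry the same restricted Lebesgue
measure. [folklore] -/
theorem restrict_halfOpenCube_eq_restrict_openCube :
    volume.restrict {x : EuclideanSpace ℝ (Fin 3) | ∀ i : Fin 3, (-1 : ℝ) ≤ x i ∧ x i < 1} =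
      volume.restrict {x : EuclideanSpace ℝ (Fin 3) | ∀ i : Fin 3, |x i| < 1} := by
  refine Measure.restrict_congr_set ?_
  refine (ae_eq_set).2 ⟨volume_halfOpenCube_diff_openCube, ?_⟩
  rw [Set.sdiff_eq_empty.2 openCube_subset_halfOpenCube, measure_empty]

/-- On a dyadic cell, restricting first to `Q` changes nothing:
`(volume.restrict Q).restrict D_{m,j} = volume.restrict D_{m,j}`. [folklore] -/
theorem restrict_openCube_restrict_dyadicCell (m : ℕ) (j : Fin 3 → Fin (2 ^ m)) :
    (volume.restrict {x : EuclideanSpace ℝ (Fin 3) | ∀ i : Fin 3, |x i| < 1}).restrict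
      {x : EuclideanSpace ℝ (Fin 3) | ∀ i : Fin 3,
        (-1 : ℝ) + 2 * (j i : ℕ) / (2 : ℝ) ^ m ≤ x i ∧ x i < (-1 : ℝ) + 2 * ((j i : ℕ) + 1) / (2 : ℝ) ^ m} =
    volume.restrict {x : EuclideanSpace ℝ (Fin 3) | ∀ i : Fin 3,
        (-1 : ℝ) + 2 * (j i : ℕ) / (2 : ℝ) ^ m ≤ x i ∧ x i < (-1 : ℝ) + 2 * ((j i : ℕ) + 1) / (2 : ℝ) ^ m} := by
  rw [← restrict_halfOpenCube_eq_restrict_openCube,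
    Measure.restrict_restrict (measurableSet_dyadicCube m j),
    inter_eq_self_of_subset_left (dyadicCube_subset_halfOpenCube m j)]

/-- The open cube has finite volume (`= 8`). [folklore] -/
theorem volume_openCube_lt_top :
    volume {x : EuclideanSpace ℝ (Fin 3) | ∀ i : Fin 3, |x i| < 1} < ∞ := by
  have h8 : (volume {x : EuclideanSpace ℝ (Fin 3) | ∀ i : Fin 3, |x i| < 1}).toReal = 8 * 1 ^ 3 :=
    volume_real_absCube zero_le_one
  by_contra htop
  rw [not_lt, top_le_iff] at htop
  rw [htop, ENNReal.toReal_top] at h8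
  norm_num at h8

/-- The index of the dyadic cell of level `m` containing a point of the half-open cube. [folklore] -/
theorem exists_mem_dyadicCell (m : ℕ) {x : EuclideanSpace ℝ (Fin 3)}
    (hx : ∀ i : Fin 3, (-1 : ℝ) ≤ x i ∧ x i < 1) :
    ∃ j : Fin 3 → Fin (2 ^ m), ∀ i : Fin 3,
      (-1 : ℝ) + 2 * (j i : ℕ) / (2 : ℝ) ^ m ≤ x i ∧ x i < (-1 : ℝ) + 2 * ((j i : ℕ) + 1) / (2 : ℝ) ^ m := by
  have hpow : (0 : ℝ) < (2 : ℝ) ^ m := by positivity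
  -- `t i := (x i + 1) * 2^m / 2 ∈ [0, 2^m)`
  have ht : ∀ i, 0 ≤ (x i + 1) * (2 : ℝ) ^ m / 2 ∧ (x i + 1) * (2 : ℝ) ^ m / 2 < (2 : ℝ) ^ m := by
    intro i
    obtain ⟨h1, h2⟩ := hx i
    constructor
    · have : 0 ≤ x i + 1 := by linarith
      positivity
    · have : (x i + 1) / 2 < 1 := by linarith
      calc (x i + 1) * (2 : ℝ) ^ m / 2 = ((x i + 1) / 2) * (2 : ℝ) ^ m := by ring
        _ < 1 * (2 : ℝ) ^ m := mul_lt_mul_of_pos_right this hpow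
        _ = (2 : ℝ) ^ m := one_mul _
  have hfl : ∀ i, ⌊(x i + 1) * (2 : ℝ) ^ m / 2⌋.toNat < 2 ^ m := by
    intro i
    have h0 : 0 ≤ ⌊(x i + 1) * (2 : ℝ) ^ m / 2⌋ := Int.floor_nonneg.2 (ht i).1
    have h1 : ⌊(x i + 1) * (2 : ℝ) ^ m / 2⌋ < (2 : ℤ) ^ m := by
      have := (ht i).2
      have h' : ((⌊(x i + 1) * (2 : ℝ) ^ m / 2⌋ : ℤ) : ℝ) < (2 : ℝ) ^ m :=
        lt_of_le_of_lt (Int.floor_le _) this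
      exact_mod_cast h'
    have h2 : (⌊(x i + 1) * (2 : ℝ) ^ m / 2⌋.toNat : ℤ) < (2 : ℤ) ^ m := by
      rwa [Int.toNat_of_nonneg h0]
    exact_mod_cast h2
  refine ⟨fun i => ⟨⌊(x i + 1) * (2 : ℝ) ^ m / 2⌋.toNat, hfl i⟩, fun i => ?_⟩
  have h0 : 0 ≤ ⌊(x i + 1) * (2 : ℝ) ^ m / 2⌋ := Int.floor_nonneg.2 (ht i).1
  have hcast : (((⌊(x i + 1) * (2 : ℝ) ^ m / 2⌋.toNat : ℕ) : ℝ)) =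
      ((⌊(x i + 1) * (2 : ℝ) ^ m / 2⌋ : ℤ) : ℝ) := by
    have : ((⌊(x i + 1) * (2 : ℝ) ^ m / 2⌋.toNat : ℤ)) = ⌊(x i + 1) * (2 : ℝ) ^ m / 2⌋ :=
      Int.toNat_of_nonneg h0
    exact_mod_cast this
  dsimp only
  rw [hcast]
  have hle := Int.floor_le ((x i + 1) * (2 : ℝ) ^ m / 2)
  have hlt := Int.lt_floor_add_one ((x i + 1) * (2 : ℝ) ^ m / 2)
  constructor
  · -- `-1 + 2 ⌊t⌋ / 2^m ≤ x i`
    have : 2 * ((⌊(x i + 1) * (2 : ℝ) ^ m / 2⌋ : ℤ) : ℝ) / (2 : ℝ) ^ m ≤ x i + 1 := by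
      rw [div_le_iff₀ hpow]; linarith
    linarith
  · have : x i + 1 < 2 * (((⌊(x i + 1) * (2 : ℝ) ^ m / 2⌋ : ℤ) : ℝ) + 1) / (2 : ℝ) ^ m := by
      rw [lt_div_iff₀ hpow]; linarith
    linarith

/-- Two dyadic cells of the same level containing a common point coincide (index uniqueness).
[folklore] -/
theorem dyadicCell_index_unique (m : ℕ) {x : EuclideanSpace ℝ (Fin 3)} {j j' : Fin 3 → Fin (2 ^ m)}
    (hj : ∀ i : Fin 3,
      (-1 : ℝ) + 2 * (j i : ℕ) / (2 : ℝ) ^ m ≤ x i ∧ x i < (-1 : ℝ) + 2 * ((j i : ℕ) + 1) / (2 : ℝ) ^ m)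
    (hj' : ∀ i : Fin 3,
      (-1 : ℝ) + 2 * (j' i : ℕ) / (2 : ℝ) ^ m ≤ x i ∧ x i < (-1 : ℝ) + 2 * ((j' i : ℕ) + 1) / (2 : ℝ) ^ m) :
    j = j' := by
  have hpow : (0 : ℝ) < (2 : ℝ) ^ m := by positivity
  funext i
  apply Fin.ext
  obtain ⟨h1, h2⟩ := hj i
  obtain ⟨h1', h2'⟩ := hj' i
  -- `j i < j' i + 1` and `j' i < j i + 1` as naturals
  have a1 : 2 * ((j i : ℕ) : ℝ) / (2 : ℝ) ^ m < 2 * (((j' i : ℕ) : ℝ) + 1) / (2 : ℝ) ^ m := by linarith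
  have a2 : 2 * ((j' i : ℕ) : ℝ) / (2 : ℝ) ^ m < 2 * (((j i : ℕ) : ℝ) + 1) / (2 : ℝ) ^ m := by linarith
  rw [div_lt_div_iff_of_pos_right hpow] at a1 a2
  have b1 : ((j i : ℕ) : ℝ) < ((j' i : ℕ) : ℝ) + 1 := by linarith
  have b2 : ((j' i : ℕ) : ℝ) < ((j i : ℕ) : ℝ) + 1 := by linarith
  have c1 : (j i : ℕ) < (j' i : ℕ) + 1 := by exact_mod_cast b1
  have c2 : (j' i : ℕ) < (j i : ℕ) + 1 := by exact_mod_cast b2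
  omega

/-! ## §2 The general `L²` step: weak limit from convergent set integrals on a family with dense span -/

section General

variable {X : Type*} [MeasurableSpace X] {μ : Measure X}
variable {F : Type*} [NormedAddCommGroup F] [InnerProductSpace ℝ F]

/-- `‖f‖² = ∫ ‖f x‖²` for `f ∈ L²`. [folklore] -/
theorem norm_Lp_two_sq (f : Lp F 2 μ) : ‖f‖ ^ 2 = ∫ x, ‖f x‖ ^ 2 ∂μ := by
  rw [← real_inner_self_eq_norm_sq, MeasureTheory.L2.inner_def]
  refine integral_congr_ae (Eventually.of_forall fun x => ?_)
  exact real_inner_self_eq_norm_sq (f x)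

/-- `‖toLp f‖² = ∫ ‖f x‖²` for `f` in `ℒ²`. [folklore] -/
theorem norm_toLp_two_sq {f : X → F} (hf : MemLp f 2 μ) :
    ‖hf.toLp f‖ ^ 2 = ∫ x, ‖f x‖ ^ 2 ∂μ := by
  rw [norm_Lp_two_sq]
  refine integral_congr_ae ?_
  filter_upwards [hf.coeFn_toLp] with x hx
  rw [hx]

/-- `⟪toLp f, toLp g⟫ = ∫ ⟪f x, g x⟫`. [folklore] -/
theorem inner_toLp_toLp {f g : X → F} (hf : MemLp f 2 μ) (hg : MemLp g 2 μ) :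
    ⟪hf.toLp f, hg.toLp g⟫ = ∫ x, ⟪f x, g x⟫ ∂μ := by
  rw [MeasureTheory.L2.inner_def]
  refine integral_congr_ae ?_
  filter_upwards [hf.coeFn_toLp, hg.coeFn_toLp] with x hx hy
  rw [hx, hy]

/-- `⟪toLp g, f⟫ = ∫ ⟪g x, f x⟫` for `f ∈ L²`, `g ∈ ℒ²`. [folklore] -/
theorem inner_toLp_left {g : X → F} (hg : MemLp g 2 μ) (f : Lp F 2 μ) :
    ⟪hg.toLp g, f⟫ = ∫ x, ⟪g x, f x⟫ ∂μ := by
  rw [MeasureTheory.L2.inner_def]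
  refine integral_congr_ae ?_
  filter_upwards [hg.coeFn_toLp] with x hx
  rw [hx]

variable [CompleteSpace F]

/-- `⟪𝟙_s c, toLp f⟫ = ⟪c, ∫_s f⟫`. [folklore] -/
theorem inner_indicatorConstLp_toLp {s : Set X} (hs : MeasurableSet s) (hμs : μ s ≠ ∞) (c : F)
    {f : X → F} (hf : MemLp f 2 μ) :
    ⟪indicatorConstLp 2 hs hμs c, hf.toLp f⟫ = ⟪c, ∫ x in s, f x ∂μ⟫ := by
  rw [MeasureTheory.L2.inner_indicatorConstLp_eq_inner_setIntegral]
  congr 1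
  refine setIntegral_congr_ae hs ?_
  filter_upwards [hf.coeFn_toLp] with x hx _ using hx

/-- **Weak `L²` limit from convergent set integrals.**  Let `D i` (`i : ι`) be measurable sets of
finite `μ`-measure whose indicator functions times constant vectors have DENSE SPAN in `L²(μ; F)`.
If `v k ∈ ℒ²` with `∫ ‖v k‖² ≤ Λ` and every set integral `∫_{D i} v k` converges, then there is ONE
`G ∈ ℒ²` with `∫ ‖G‖² ≤ Λ` such that, along the WHOLE sequence, `∫_{D i} v k → ∫_{D i} G` for every
`i` and `∫ ⟪ψ, v k⟫ → ∫ ⟪ψ, G⟫` for every `ψ ∈ ℒ²`.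
[folklore; Leray 1934 §28 via `Literature.Analysis.FunctionSpaces.exists_mem_tendsto_inner_of_subset_closure_span`] -/
theorem exists_weakLimit_of_setIntegral_tendsto {ι : Type*} (D : ι → Set X)
    (hDm : ∀ i, MeasurableSet (D i)) (hDμ : ∀ i, μ (D i) ≠ ∞)
    (hdense : Dense (Submodule.span ℝ
      {f : Lp F 2 μ | ∃ (i : ι) (c : F), f = indicatorConstLp 2 (hDm i) (hDμ i) c} : Set (Lp F 2 μ)))
    (v : ℕ → X → F) (hv : ∀ k, MemLp (v k) 2 μ) (Λ : ℝ) (hΛ : ∀ k, ∫ x, ‖v k x‖ ^ 2 ∂μ ≤ Λ)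
    (hmean : ∀ i, ∃ g : F, Tendsto (fun k => ∫ x in D i, v k x ∂μ) atTop (𝓝 g)) :
    ∃ G : X → F, MemLp G 2 μ ∧ ∫ x, ‖G x‖ ^ 2 ∂μ ≤ Λ ∧
      (∀ i, Tendsto (fun k => ∫ x in D i, v k x ∂μ) atTop (𝓝 (∫ x in D i, G x ∂μ))) ∧
      ∀ ψ : X → F, MemLp ψ 2 μ →
        Tendsto (fun k => ∫ x, ⟪ψ x, v k x⟫ ∂μ) atTop (𝓝 (∫ x, ⟪ψ x, G x⟫ ∂μ)) := by
  have hΛ0 : 0 ≤ Λ := le_trans (integral_nonneg fun x => sq_nonneg _) (hΛ 0)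
  have hVnorm : ∀ k, ‖(hv k).toLp (v k)‖ ≤ Real.sqrt Λ := fun k => by
    rw [← Real.sqrt_sq (norm_nonneg ((hv k).toLp (v k)))]
    exact Real.sqrt_le_sqrt (by rw [norm_toLp_two_sq]; exact hΛ k)
  -- the pairing with a cell indicator is the (inner product with the) cell integral
  have hpair : ∀ (i : ι) (c : F) (k : ℕ),
      ⟪(hv k).toLp (v k), indicatorConstLp 2 (hDm i) (hDμ i) c⟫ = ⟪c, ∫ x in D i, v k x ∂μ⟫ :=
    fun i c k => by rw [real_inner_comm, inner_indicatorConstLp_toLp]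
  have hpair_tendsto : ∀ (i : ι) (c : F) (g : F),
      Tendsto (fun k => ∫ x in D i, v k x ∂μ) atTop (𝓝 g) →
      Tendsto (fun k => ⟪(hv k).toLp (v k), indicatorConstLp 2 (hDm i) (hDμ i) c⟫) atTop (𝓝 ⟪c, g⟫) :=
    fun i c g hg => by
      simp_rw [hpair]
      exact tendsto_const_nhds.inner hg
  have hconv : ∀ d ∈ {f : Lp F 2 μ | ∃ (i : ι) (c : F), f = indicatorConstLp 2 (hDm i) (hDμ i) c},
      ∃ l : ℝ, Tendsto (fun k => ⟪(hv k).toLp (v k), d⟫) atTop (𝓝 l) := by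
    rintro d ⟨i, c, rfl⟩
    obtain ⟨g, hg⟩ := hmean i
    exact ⟨⟪c, g⟫, hpair_tendsto i c g hg⟩
  have htop_closed : IsClosed ((⊤ : Submodule ℝ (Lp F 2 μ)) : Set (Lp F 2 μ)) := by
    rw [Submodule.top_coe]; exact isClosed_univ
  have htop_sub : ((⊤ : Submodule ℝ (Lp F 2 μ)) : Set (Lp F 2 μ)) ⊆ closure (Submodule.span ℝ
      {f : Lp F 2 μ | ∃ (i : ι) (c : F), f = indicatorConstLp 2 (hDm i) (hDμ i) c} : Set (Lp F 2 μ)) := by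
    rw [hdense.closure_eq]; exact subset_univ _
  obtain ⟨w, -, hwM, hw⟩ :=
    Literature.Analysis.FunctionSpaces.exists_mem_tendsto_inner_of_subset_closure_span
      (⊤ : Submodule ℝ (Lp F 2 μ)) htop_closed htop_sub (v := fun k => (hv k).toLp (v k))
      (fun _ => Submodule.mem_top) hVnorm hconv
  refine ⟨w, Lp.memLp w, ?_, ?_, ?_⟩
  · rw [← norm_Lp_two_sq]
    calc ‖w‖ ^ 2 ≤ (Real.sqrt Λ) ^ 2 := pow_le_pow_left₀ (norm_nonneg _) hwM 2
      _ = Λ := Real.sq_sqrt hΛ0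
  · intro i
    obtain ⟨g, hg⟩ := hmean i
    have hgi : ∫ x in D i, (w : X → F) x ∂μ = g := by
      apply ext_inner_left ℝ
      intro c
      have h1 := hw (indicatorConstLp 2 (hDm i) (hDμ i) c)
      have h2 := hpair_tendsto i c g hg
      have h3 := tendsto_nhds_unique h1 h2
      rwa [real_inner_comm, MeasureTheory.L2.inner_indicatorConstLp_eq_inner_setIntegral] at h3
    rw [hgi]
    exact hg
  · intro ψ hψ
    have h1 := hw (hψ.toLp ψ)
    have e1 : ∀ k, ⟪(hv k).toLp (v k), hψ.toLp ψ⟫ = ∫ x, ⟪ψ x, v k x⟫ ∂μ := fun k => by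
      rw [real_inner_comm, inner_toLp_toLp]
    have e2 : ⟪w, hψ.toLp ψ⟫ = ∫ x, ⟪ψ x, (w : X → F) x⟫ ∂μ := by
      rw [real_inner_comm, inner_toLp_left]
    simp_rw [e1, e2] at h1
    exact h1

end General

end Summit.QuantumFields.YangMills.Theorems.PoincareLipschitzDyadicMeansWeakLimit
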